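import Summits.CriticalPhenomena.Ising3DConformalLimit.Theorems.HyperoctahedralRPExistsScaleCovariantLimitFunnelThroughDoubling
import Summits.CriticalPhenomena.Ising3DConformalLimit.Theorems.HyperoctahedralRPExistsScaleCovariantLimitFoldedCurrentUniqueness
import Summits.CriticalPhenomena.Ising3DConformalLimit.Theorems.PositivityBegetsConformalityMoebiusOfInversionPositive
import Summits.CriticalPhenomena.Ising3DConformalLimit.Theses.PositivityBegetsConformality
import HarnessLib

/-!
# Route `PositivityBegetsConformality`, crux #4 `(E₀)` = shared item stmt-CriticalPhenomena-1981: item maps BY NAME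

Line lead `prover-line-stmt-CriticalPhenomena-1981-c15-0` (route re-audit HONEST of `route-CriticalPhenomena-PositivityBegetsConformality`;
crux `ExistsScaleCovariantLimit`, line `folded-current-repulsion`). The route file declares its OWN copy
`Theses.PositivityBegetsConformality.ExistsScaleCovariantLimit` of the shared statement (same body as
`Theses.HyperoctahedralRP.ExistsScaleCovariantLimit`, on which every landed certificate of the crux chain is stated). This file
transports the kernel-checked status of the crux to the route's copy, so that the re-audit of THIS route reads certificates that
conclude or consume its decl by name:

* `crux_iff_hrp` — the two route copies are the same proposition (`Iff.rfl`);
* `crux_iff_pointwiseLimit` — the route's crux ⟺ item stmt-CriticalPhenomena-6153 `MirrorHoelderCompactness.PointwiseLimit`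
  (full-filter pointwise convergence of the pinned zoom; p123864);
* `pbc_crux_iff_doubling_and_totallyDisconnected` (registered sub-goal) — the route's crux ⟺ item 6150 `TwoPointDoubling` ∧ item 4659
  `ClusterRigidity.ClusterSetTotallyDisconnected` (the exact split of line `folded-current-repulsion`, p139907), with the two
  one-way forms `twoPointDoubling_of_crux` (the crux forces the OPEN all-scale axis doubling of Aizenman–Duminil-Copin 2021,
  Remark 5.10) and `crux_of_doubling_of_totallyDisconnected` (the glue recipe the day both items land);
* `summit_of_items` — the route's deciding theorem `closes` with its proved support `MoebiusOfInversionPositive` (item 4673,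
  `moebiusOfInversionPositive_proof`) discharged and its crux #4 replaced by the two blocker items: the sub-problem
  `Ising3DConformalLimit` follows from `InversionPositiveLimit` (4671), `TwoPointDoubling` (6150),
  `ClusterSetTotallyDisconnected` (4659) and `IsingEuclidUpgradeR4NonGaussian` (0636) — the honest residual of the route.

No statement is weakened or strengthened; everything is composition of landed theorems.

References: H. Duminil-Copin, ICM 2022 §8.4; M. Aizenman, H. Duminil-Copin, Ann. Math. 194 (2021), Remark 5.10; G. Mack, 1975.
-/

namespace Summit.CriticalPhenomena.Ising3DConformalLimit.Cruxes.ExistsScaleCovariantLimit.PositivityBegetsConformalityMaps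

open Literature.Probability.LatticeModels
open Summit.CriticalPhenomena.Ising3DConformalLimit.Theses

/-- The route copy of the shared crux is the HyperoctahedralRP copy (same body). [folklore] -/
theorem crux_iff_hrp :
    PositivityBegetsConformality.ExistsScaleCovariantLimit ↔ HyperoctahedralRP.ExistsScaleCovariantLimit :=
  Iff.rfl

/-- **Route PBC's crux ⟺ item 6153 `PointwiseLimit`.** [cite: DuminilCopinICM2022, §8.4 p. 29] -/
theorem crux_iff_pointwiseLimit :
    PositivityBegetsConformality.ExistsScaleCovariantLimit ↔ MirrorHoelderCompactness.PointwiseLimit :=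
  crux_iff_hrp.trans TwoHierarchies.crux_iff_pointwiseLimit

/-- **Route PBC's crux ⟺ item 6150 `TwoPointDoubling` ∧ item 4659 `ClusterSetTotallyDisconnected`.**
[cite: AizenmanDuminilCopinAnnals2021, arXiv:1912.07973 Remark 5.10] -/
theorem pbc_crux_iff_doubling_and_totallyDisconnected : PositivityBegetsConformality.ExistsScaleCovariantLimit ↔ MirrorHoelderCompactness.TwoPointDoubling ∧ ClusterRigidity.ClusterSetTotallyDisconnected :=
  crux_iff_hrp.trans FoldedCurrentRepulsion.crux_iff_doubling_and_totallyDisconnected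

/-- The route's crux forces the open all-scale axis doubling (item 6150). [cite: AizenmanDuminilCopinAnnals2021, arXiv:1912.07973 Remark 5.10] -/
theorem twoPointDoubling_of_crux (h : PositivityBegetsConformality.ExistsScaleCovariantLimit) :
    MirrorHoelderCompactness.TwoPointDoubling :=
  Funnel.twoPointDoubling_of_crux (crux_iff_hrp.1 h)

/-- Contrapositive: a refutation of item 6150 refutes the route's crux. [folklore] -/
theorem not_crux_of_not_twoPointDoubling (h : ¬ MirrorHoelderCompactness.TwoPointDoubling) :
    ¬ PositivityBegetsConformality.ExistsScaleCovariantLimit :=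
  fun h' => h (twoPointDoubling_of_crux h')

/-- Contrapositive: a refutation of item 4659 refutes the route's crux. [folklore] -/
theorem not_crux_of_not_totallyDisconnected (h : ¬ ClusterRigidity.ClusterSetTotallyDisconnected) :
    ¬ PositivityBegetsConformality.ExistsScaleCovariantLimit :=
  fun h' => h (pbc_crux_iff_doubling_and_totallyDisconnected.1 h').2

/-- **The glue recipe**: items 6150 and 4659 together give the route's crux by name. [folklore] -/
theorem crux_of_doubling_of_totallyDisconnected (hD : MirrorHoelderCompactness.TwoPointDoubling)
    (hT : ClusterRigidity.ClusterSetTotallyDisconnected) :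
    PositivityBegetsConformality.ExistsScaleCovariantLimit :=
  pbc_crux_iff_doubling_and_totallyDisconnected.2 ⟨hD, hT⟩

/-- Item 6153 alone gives the route's crux by name. [folklore] -/
theorem crux_of_pointwiseLimit (h : MirrorHoelderCompactness.PointwiseLimit) :
    PositivityBegetsConformality.ExistsScaleCovariantLimit :=
  crux_iff_pointwiseLimit.2 h

/-- **The honest residual of route `PositivityBegetsConformality`**: with its support `MoebiusOfInversionPositive` (item 4673)
proved and its crux #4 split exactly into items 6150 ∧ 4659, the route's deciding theorem `closes` yields the sub-problem
`Ising3DConformalLimit` from the four open items `InversionPositiveLimit` (4671), `TwoPointDoubling` (6150),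
`ClusterSetTotallyDisconnected` (4659) and `IsingEuclidUpgradeR4NonGaussian` (0636). [cite: Mack1975] -/
theorem summit_of_items (hIP : PositivityBegetsConformality.InversionPositiveLimit)
    (hD : MirrorHoelderCompactness.TwoPointDoubling) (hT : ClusterRigidity.ClusterSetTotallyDisconnected)
    (hNG : PositivityBegetsConformality.IsingEuclidUpgradeR4NonGaussian) : _root_.Ising3DConformalLimit :=
  PositivityBegetsConformality.closes hIP
    PositivityBegetsConformalityMoebiusOfInversionPositive.moebiusOfInversionPositive_proof
    (crux_of_doubling_of_totallyDisconnected hD hT) hNG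

/-- The same residual with item 6153 in place of 6150 ∧ 4659. [cite: DuminilCopinICM2022, §8.4 p. 29] -/
theorem summit_of_items' (hIP : PositivityBegetsConformality.InversionPositiveLimit)
    (hPL : MirrorHoelderCompactness.PointwiseLimit)
    (hNG : PositivityBegetsConformality.IsingEuclidUpgradeR4NonGaussian) : _root_.Ising3DConformalLimit :=
  PositivityBegetsConformality.closes hIP
    PositivityBegetsConformalityMoebiusOfInversionPositive.moebiusOfInversionPositive_proof
    (crux_of_pointwiseLimit hPL) hNG

end Summit.CriticalPhenomena.Ising3DConformalLimit.Cruxes.ExistsScaleCovariantLimit.PositivityBegetsConformalityMaps
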